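import Summits.RiemannHypothesis.RiemannHypothesis.Theorems.SignConeGradedFamilyShadows
import Summits.RiemannHypothesis.RiemannHypothesis.Theorems.SignConeGapRungOne

/-!
# Line `near-clean-three` — the WITNESS (floor rung) of the near-clean ladder below `SignConeOscillatory`

The special case of the rung `NearCleanThree := NearCleanRung 3` that is ALREADY A THEOREM: the floor
`NearCleanRung (13/5)` (negativity of `Re F` only below height `13/5`, EVERY cutoff), proved by erasure with the
plain pointwise certificate `pwCert13s` (`nearCleanRung_thirteen_fifths`, `Theorems/SignConeGapRungOne.lean`, p170128).
It is NOT covered by any landed instance of the top: the cutoff rungs (`cutoffRung_three_halves`, PT-conditional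
`cutoffRung_two_of_plattTrudgian`) fix the support, whereas this holds at every cutoff `a`; and `GapRung 1` allows one
dirty gap, whereas this allows every dirty pattern among the gaps `2 … 12`.
-/

noncomputable section

set_option linter.dupNamespace false

namespace Summit.RiemannHypothesis.RiemannHypothesis.Cruxes.SignConeOscillatory.NearCleanThree

open Summit.RiemannHypothesis.RiemannHypothesis.Theorems.SignCone

/-- **The floor rung holds** (witness for BC5-style weakness of the near-clean ladder). [folklore] -/
theorem special_holds : NearCleanRung (13 / 5) := nearCleanRung_thirteen_fifths

/-- The floor also gives every lower rung, e.g. `log 13` (all dirty sets inside the gaps `2 … 12`). [folklore] -/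
theorem special_log_thirteen : NearCleanRung (Real.log 13) :=
  nearCleanRung_anti log_thirteen_lt.le nearCleanRung_thirteen_fifths

end Summit.RiemannHypothesis.RiemannHypothesis.Cruxes.SignConeOscillatory.NearCleanThree

end
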